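import Summits.BirchSwinnertonDyer.BirchSwinnertonDyer.Theorems.ManinLocalTwoThreeManinConstantTwoHundredC
import Summits.BirchSwinnertonDyer.BirchSwinnertonDyer.Theorems.ManinLocalTwoThreeEvenCoeffVanishing
import Summits.BirchSwinnertonDyer.BirchSwinnertonDyer.Theorems.ManinLocalTwoThreeNewformPinningForty
import HarnessLib

/-!
# The root form `φ₄₀`: vanishing of the even coefficients (`a₂ₖ(φ₄₀) = 0`) — the `heven` input of the two-twist transports rooted at `40`

Cell bsd-f2-manin, route `ManinLocalTwoThree` (crux C2 `ManinOddAtFour`, stmt-BirchSwinnertonDyer-22967; `--supports` helper), LEAD p1 gen 26.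
`LevelTwoHundred.phiForty : CuspForm (Gamma0 40) 2` (the newform `40a` as a datum-free term, `…ManinConstantTwoHundredC`) is the root of the
classes `320a, 320b = 40a ⊗ χ₈′/χ₈` (kernel census, LEAD-MEMO v44 §6–§7); desc's two-twist squeeze transport
(`TwistDefect.abs_maninConstant_eq_one_of_squeeze_twoTwist_aligned_level`, `M = 40`, `8² ∣ 320`) needs, besides the squeeze
`EtaIdentitiesForty.periodLatticeLe_forty phiForty coe_phiForty`, the hypothesis `heven : ∀ n, 2 ∣ n → aₙ(φ₄₀) = 0`.  Here it is, by the
`U₂`–Sturm device of `…EvenCoeffVanishing` (`2 ∣ 40`; the table `tPhiForty` vanishes at the even indices `< 26`; Sturm bound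
`⌊2·μ₀(40)/12⌋ = 12 < 13`).  HONEST FRAMING: unconditional bookkeeping; nothing here proves C2/C3, Manin's conjecture or BSD.
[cite: DiamondShurman2005, Prop. 5.2.2] [cite: Sturm1987, Thm. 1]
-/

set_option autoImplicit false
-- lint-debt: the directory name repeats the summit name (sibling precedent `ManinLocalTwoThreeEvenCoeffVanishing.lean`)
set_option linter.dupNamespace false

noncomputable section

open scoped MatrixGroups ModularForm
open ModularForm CongruenceSubgroup
open Literature.NumberTheory.ModularForms
open Literature.NumberTheory.EllipticCurves Literature.NumberTheory.EllipticCurves.ModularForms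

namespace Summit.BirchSwinnertonDyer.BirchSwinnertonDyer.Theorems.ManinLocalTwoThree.LevelTwoHundred

open Summit.BirchSwinnertonDyer.BirchSwinnertonDyer.Theorems.ManinLocalTwoThree
open EvenCoeffVanishing

/-- The even entries of `tPhiForty` below `26` vanish (kernel check). [folklore] -/
theorem tPhiForty_even_eq_zero : ∀ n < 13, tPhiForty.getD (2 * n) 0 = 0 := by
  decide

/-- **`a₂ₖ(φ₄₀) = 0` for every `k`** (`40a` has additive reduction at `2`): `U₂φ₄₀ ∈ S₂(Γ₀(40))` has vanishing coefficients below the Sturm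
bound, hence is `0`. [cite: DiamondShurman2005, Prop. 5.2.2] [cite: Sturm1987, Thm. 1] -/
theorem cuspCoeff_even_phiForty : ∀ n : ℕ, 2 ∣ n → cuspCoeff phiForty n = 0 := by
  have hμ : gamma0Index 40 = 72 := NewformForty.gamma0_data_40.1
  exact cuspCoeff_even_eq_zero_of_table (by norm_num) phiForty (m := 13) (K := 128) (by rw [hμ]; decide) (by norm_num)
    tPhiForty tPhiForty_eq_cuspCoeff tPhiForty_even_eq_zero

end Summit.BirchSwinnertonDyer.BirchSwinnertonDyer.Theorems.ManinLocalTwoThree.LevelTwoHundred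

end
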